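import Summits.KontsevichZagierPeriods.KontsevichZagierPeriods.Theses.UnfoldedStokes
import Summits.KontsevichZagierPeriods.KontsevichZagierPeriods.Theses.LiftingCriteria
import Literature.NumberTheory.Transcendental.KZKernelConjectureForms
import Literature.NumberTheory.Transcendental.KZCalculusProofs
import Literature.NumberTheory.Transcendental.KZGroundingRelations
import Literature.NumberTheory.Transcendental.AyoubPeriodSeries
import Summits.KontsevichZagierPeriods.KontsevichZagierPeriods.Theorems.UnfoldedStokesStokesGenerationStubCubeCalibration
import Summits.KontsevichZagierPeriods.KontsevichZagierPeriods.Theorems.UnfoldedStokesStokesGenerationStubMergeCubes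
import Summits.KontsevichZagierPeriods.KontsevichZagierPeriods.Theorems.UnfoldedStokesStokesGenerationStubNashToGerm
import Summits.KontsevichZagierPeriods.KontsevichZagierPeriods.Theorems.UnfoldedStokesStokesGenerationStubGermToOan
import Summits.KontsevichZagierPeriods.KontsevichZagierPeriods.Theorems.UnfoldedStokesStokesGenerationStubSpanToReps
import Summits.KontsevichZagierPeriods.KontsevichZagierPeriods.Theorems.LiftingCriteriaCubeNashNormalFormReduction
import Summits.KontsevichZagierPeriods.KontsevichZagierPeriods.Theorems.LiftingCriteriaCubeNashNormalFormDimLeOne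

/-!
# `StokesGeneration` (stmt-KontsevichZagierPeriods-3586), line `Sketch`: the LINE REDUCTION

Sorry-free composition of the line `Sketch` (card `Cruxes/StokesGeneration/Ideas/cube-type-a-generation.md`)
for the crux `StokesGeneration` of route UnfoldedStokes, with its two open stubs made HYPOTHESES:

* **(T)** = `stub_typeAGeneration`, Ayoub's Conjecture 1.1 (Ann. of Math. 181 (2015), Conj. 1.1 with
  Rem. 1.2; = Fresán 2024, Conj. 3.5) typed over `AyoubPeriodSeries.lean`, here only in the instance the
  line uses, `k = ℚ̄ = algebraicClosure ℚ ℂ`: every `F ∈ 𝒪_{ℚ̄-alg}(𝔻̄^∞)` (`AyoubRel.Oan`) with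
  `∫_{[0,1]^∞} F = 0` (`AyoubRel.intC`) lies in the `ℚ̄`-span of the type-(a) elements
  `∂G/∂zᵢ − G|_{zᵢ=1} + G|_{zᵢ=0}` (`AyoubRel.relAC i G`), `G ∈ 𝒪_{ℚ̄-alg}(𝔻̄^∞)`. OPEN; with (N₁) it is
  summit-strength (`Theorems/StokesGeneration/Negative/IffSummit.lean`).
* **(N₁)** = `stub_cubeNashNormalForm` = verbatim the support item `CubeNashNormalForm`
  (stmt-KontsevichZagierPeriods-3574, route LiftingCriteria): cube–Nash normal form of differences of
  KZ-rational representations inside the moves (embedded resolution of singularities over `ℝ` in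
  ambient dimension `≥ 3` is its open part; dimensions `≤ 2` are in the tree).

What is proved (all sorry-free, over the landed stubs N₂ `stub_nashToGerm` p101780, merge
`stub_mergeCubes` p99241, D `stub_germToOan` p109733, R `stub_spanToReps` p113092, C
`stub_cubeCalibration` p97569):

* §1 glue: lifting a closed-cube representation to a higher-dimensional cube inside the moves.
* §2 **(T) alone ⇒ the Kontsevich–Zagier conjecture for cube–Nash combinations**
  (`sum_cubeNash_mem_relations_of_typeA`): a `ℤ`-combination of closed-cube representations with
  integrands `ℚ`-semialgebraic and real-analytic near the closed cube whose VALUE is `0` is a relation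
  of the four-move calculus; equivalently (`mem_relations_of_mem_sup_cubeNash_of_typeA`) `ker eval`
  meets the subgroup `relations ⊔ closure {cube–Nash generators}` inside `relations`.
* §3 **(T) ∧ (N₁) ⇒ `KZKernelConjecture`, ⇒ the crux `StokesGeneration`, ⇒ the summit
  `KontsevichZagierPeriods`**; and the registered-stub form
  `stub_lineReduction : (N₁ verbatim) → (T verbatim, all fields `k`) → StokesGeneration`.
* §4 **(T) alone ⇒ the Kontsevich–Zagier conjecture for formal combinations of representations of
  dimension `≤ 1`** (`mem_relations_of_dimLEOne_of_typeA`, `equivalent_of_value_eq_of_dimLEOne_of_typeA`):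
  (N₁) is NOT needed there, because representations of dimension `≤ 1` reduce inside the moves to
  bounded plane volumes (`KZ.exists_sub_isBounded`) and those to cube–Nash combinations
  (LiftingCriteria's landed `CubeNashNormalFormDimLeOne.of_mem_of_dim_le_one`, built on
  `of_mem_of_volume_two`, `of_mem_of_Ioo`, `of_mem_of_dim_one`).

Nothing here is asserted unconditionally about (T): it is a published OPEN conjecture and enters only
as an explicit hypothesis (written out, no definition is introduced in this proof file).

References: Kontsevich–Zagier 2001 §1.2 Conjecture 1; Ayoub 2015 Conj. 1.1, Rem. 1.2; Ayoub 2014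
(EMS Newsl. 91) §2.2, Prop. 11; Fresán 2024 Conj. 3.5, Rem. 3.6–3.7; Huber–Müller-Stach 2017 Ch. 12–13.
-/

noncomputable section

-- `Summit.KontsevichZagierPeriods.KontsevichZagierPeriods.…` is the tree's mandated layout (single-conjunct summit).
set_option linter.dupNamespace false

namespace Summit.KontsevichZagierPeriods.KontsevichZagierPeriods.StokesGenerationLine

open MeasureTheory Set
open Literature.NumberTheory.Transcendental
open Literature.NumberTheory.Transcendental.KZ
open Summit.KontsevichZagierPeriods.KontsevichZagierPeriods.Theses.UnfoldedStokes (StokesGeneration)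
open Summit.KontsevichZagierPeriods.KontsevichZagierPeriods.Theses.LiftingCriteria (CubeNashNormalForm)
open Summit.KontsevichZagierPeriods.LiftingCriteria.CubeNashNormalFormReduction (exists_normalForm_of_mem_sup)
open Summit.KontsevichZagierPeriods.LiftingCriteria.CubeNashNormalFormDimLeOne (of_mem_of_dim_le_one)

/-! ## §1 Glue: measurability of the cube, domain rewriting, lifting to higher cubes -/

/-- The closed unit cube written as `Set.pi univ (fun _ => Icc 0 1)` is measurable. [folklore] -/
theorem measurableSet_unitCubePi (N : ℕ) :
    MeasurableSet (Set.pi Set.univ (fun _ : Fin N => Set.Icc (0:ℝ) 1)) :=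
  MeasurableSet.univ_pi fun _ => measurableSet_Icc

/-- Rewriting the domain of a representation along a set equality (the representation with the
rewritten domain is the same structure). [folklore] -/
theorem exists_rep_of_domain_eq {N : ℕ} (r : IntegralRep N) {s : Set (Fin N → ℝ)} (hs : r.domain = s) :
    ∃ r' : IntegralRep N, r'.domain = s ∧ r'.integrand = r.integrand ∧ of r - of r' ∈ relations := by
  subst hs
  exact ⟨r, rfl, rfl, by simp [relations.zero_mem]⟩

/-- **Lifting a cube representation by one slab**: `[□ᴺ, f] ∼ [□ᴺ⁺¹, f ∘ init]` (one Newton–Leibniz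
move with primitive `t · f`, `KZ.IntegralRep.slab`). [cite: KontsevichZagier2001, §1.2 rule (3)] -/
theorem exists_liftCube_succ (N : ℕ) (t : IntegralRep N)
    (ht : t.domain = Set.pi Set.univ (fun _ : Fin N => Set.Icc (0:ℝ) 1)) :
    ∃ t' : IntegralRep (N + 1), t'.domain = Set.pi Set.univ (fun _ : Fin (N + 1) => Set.Icc (0:ℝ) 1) ∧
      (∀ x ∈ Set.pi Set.univ (fun _ : Fin (N + 1) => Set.Icc (0:ℝ) 1),
        t'.integrand x = t.integrand (Fin.init x)) ∧
      of t - of t' ∈ relations := by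
  have hdom : (t.slab 0).domain = Set.pi Set.univ (fun _ : Fin (N + 1) => Set.Icc (0:ℝ) 1) := by
    ext z
    simp only [IntegralRep.domain_slab, IntegralRep.slabDomain, ht, Nat.cast_zero, zero_add,
      mem_setOf_eq, mem_pi, mem_univ, true_implies, mem_Icc]
    constructor
    · rintro ⟨h1, h2, h3⟩ i
      refine Fin.lastCases ?_ (fun j => ?_) i
      · exact ⟨h2, h3⟩
      · simpa [Fin.init] using h1 j
    · intro hz
      exact ⟨fun j => by simpa [Fin.init] using hz (Fin.castSucc j), (hz (Fin.last N)).1,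
        (hz (Fin.last N)).2⟩
  obtain ⟨t', ht'd, ht'i, hrel⟩ := exists_rep_of_domain_eq (t.slab 0) hdom
  refine ⟨t', ht'd, fun x _ => by rw [ht'i]; rfl, ?_⟩
  have h1 : of (t.slab 0) - of t ∈ relations :=
    newtonLeibnizRel_subset_relations (t.of_slab_sub_of_mem_newtonLeibnizRel 0)
  have : of t - of t' = -(of (t.slab 0) - of t) + (of (t.slab 0) - of t') := by abel
  rw [this]
  exact relations.add_mem (relations.neg_mem h1) hrel

/-- **Lifting a cube representation to any higher dimension**: `[□ᴺ, f] ∼ [□ᴹ, f ∘ pr]` for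
`N ≤ M`, `pr` the projection to the first `N` coordinates (iterate `exists_liftCube_succ`).
[cite: KontsevichZagier2001, §1.2 rule (3)] -/
theorem exists_liftCube (N M : ℕ) (hNM : N ≤ M) (t : IntegralRep N)
    (ht : t.domain = Set.pi Set.univ (fun _ : Fin N => Set.Icc (0:ℝ) 1)) :
    ∃ t' : IntegralRep M, t'.domain = Set.pi Set.univ (fun _ : Fin M => Set.Icc (0:ℝ) 1) ∧
      (∀ x ∈ Set.pi Set.univ (fun _ : Fin M => Set.Icc (0:ℝ) 1),
        t'.integrand x = t.integrand (fun l => x (Fin.castLE hNM l))) ∧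
      of t - of t' ∈ relations := by
  obtain ⟨d, rfl⟩ := Nat.exists_eq_add_of_le hNM
  induction d with
  | zero =>
    refine ⟨t, ht, fun x _ => ?_, by simp [relations.zero_mem]⟩
    rfl
  | succ d ih =>
    obtain ⟨t₁, ht₁d, ht₁i, ht₁r⟩ := ih (Nat.le_add_right N d)
    obtain ⟨t₂, ht₂d, ht₂i, ht₂r⟩ := exists_liftCube_succ (N + d) t₁ ht₁d
    refine ⟨t₂, ht₂d, fun x hx => ?_, ?_⟩
    · rw [ht₂i x hx, ht₁i (Fin.init x) (fun j _ => hx (Fin.castSucc j) (mem_univ _))]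
      rfl
    · have : of t - of t₂ = (of t - of t₁) + (of t₁ - of t₂) := by abel
      rw [this]
      exact relations.add_mem ht₁r ht₂r

/-! ## §2 (T) alone: the period conjecture for cube–Nash combinations -/

/-- **Ayoub's Conjecture 1.1 (over `ℚ̄`) implies the Kontsevich–Zagier conjecture for cube–Nash
combinations.** Let `sᵢ = [□^{nᵢ}, gᵢ]` be finitely many closed-cube representations whose integrands
are `ℚ`-semialgebraic and real-analytic on open neighbourhoods of the closed cubes, `εᵢ ∈ ℤ`, and
suppose the VALUE of `Σ εᵢ [sᵢ]` vanishes. If the type-(a) elements span the kernel of `∫_{[0,1]^∞}` on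
`𝒪_{ℚ̄-alg}(𝔻̄^∞)` (hypothesis `hT`, Ayoub 2015 Conj. 1.1 for `k = ℚ̄`), then `Σ εᵢ [sᵢ]` is a relation
of the four-move calculus. Chain: germ cubes (N₂) ⇒ one germ cube `[□ᴺ, h]` (merge) ⇒ `∫_{□ᴺ} h = 0`
(soundness) ⇒ `F ∈ Oan`, `intC F = 0` (D) ⇒ `F ∈ ⟨type (a)⟩_ℚ̄` (T) ⇒ `[□ᴹ, h ∘ pr] = Σⱼ [□ᴹ, ∂Gⱼ − Gⱼ|₁ +
Gⱼ|₀]` (R, lifting, integrand additivity) ⇒ each term is a relation (C).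
[cite: Ayoub2015, Conj. 1.1] -/
theorem sum_cubeNash_mem_relations_of_typeA
    (hT : ∀ F ∈ AyoubRel.Oan (algebraMap (algebraicClosure ℚ ℂ) ℂ), AyoubRel.intC F = 0 →
      F ∈ AyoubRel.kSpan (algebraMap (algebraicClosure ℚ ℂ) ℂ)
        {x : AyoubRel.CSeries | ∃ G ∈ AyoubRel.Oan (algebraMap (algebraicClosure ℚ ℂ) ℂ),
          ∃ i : ℕ, x = AyoubRel.relAC i G})
    (S : ℕ) (nS : Fin S → ℕ) (g : (i : Fin S) → (Fin (nS i) → ℝ) → ℝ)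
    (U : (i : Fin S) → Set (Fin (nS i) → ℝ)) (ε : Fin S → ℤ) (s : (i : Fin S) → IntegralRep (nS i))
    (hNash : ∀ i, IsOpen (U i) ∧ Set.pi Set.univ (fun _ : Fin (nS i) => Set.Icc (0:ℝ) 1) ⊆ (U i) ∧
      IsSemialgebraicFunOn ℚ (U i) (g i) ∧ AnalyticOnNhd ℝ (g i) (U i))
    (hs : ∀ i, (s i).domain = Set.pi Set.univ (fun _ : Fin (nS i) => Set.Icc (0:ℝ) 1) ∧
      ∀ z ∈ Set.pi Set.univ (fun _ : Fin (nS i) => Set.Icc (0:ℝ) 1), (s i).integrand z = g i z)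
    (h0 : eval (∑ i, ε i • of (s i)) = 0) :
    ∑ i, ε i • of (s i) ∈ relations := by
  classical
  -- (3) germ cubes
  have hgerm := fun i : Fin S =>
    stub_nashToGerm (nS i) (g i) (U i) (s i) (hNash i).1 (hNash i).2.1 (hNash i).2.2.1
      (hNash i).2.2.2 (hs i).1 (hs i).2
  choose h V c Rr t hV hVsub hsa hR1 hsum hHas htd hti hst using hgerm
  -- (4) merge
  obtain ⟨N, h', V', c', R₁, t', hV', hV'sub, hsa', hR1', hsum', hHas', ht'd, ht'i, hmerge⟩ :=
    stub_mergeCubes S nS ε h V c Rr t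
      (fun i => ⟨hV i, hVsub i, hsa i, hR1 i, hsum i, hHas i, htd i, hti i⟩)
  -- (5) `Σ εᵢ [sᵢ] ≡ [t']`
  have hxt' : ∑ i, ε i • of (s i) - of t' ∈ relations := by
    have e3 : ∑ i, ε i • (of (s i) - of (t i)) ∈ relations :=
      AddSubgroup.sum_mem _ fun i _ => AddSubgroup.zsmul_mem _ (hst i) _
    have : ∑ i, ε i • of (s i) - of t' =
        ∑ i, ε i • (of (s i) - of (t i)) + (∑ i, ε i • of (t i) - of t') := by
      simp only [smul_sub, Finset.sum_sub_distrib]; abel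
    rw [this]
    exact relations.add_mem e3 hmerge
  -- (6) the value vanishes
  have hval : (∫ z in Set.pi Set.univ (fun _ : Fin N => Set.Icc (0:ℝ) 1), h' z) = 0 := by
    have hv0 : eval (of t') = 0 := by
      have := relations_le_ker_eval_holds hxt'
      rwa [AddMonoidHom.mem_ker, map_sub, h0, zero_sub, neg_eq_zero] at this
    rw [eval_of, IntegralRep.value, ht'd, setIntegral_congr_fun (measurableSet_unitCubePi N)
      (fun z hz => ht'i z hz)] at hv0
    exact hv0
  -- (7) dictionary: the germ as an element of `Oan`, with `intC = 0`
  obtain ⟨F, hFc, hFz, hFO, hFint⟩ :=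
    stub_germToOan N h' V' c' R₁ hV' hV'sub hsa' hR1' hsum' hHas'
  have hF0 : AyoubRel.intC F = 0 := by rw [hFint, hval]; simp
  -- (8) the open core: type-(a) generation (hypothesis)
  have hspan := hT F hFO hF0
  -- (9) fold back to real `C¹` semialgebraic type-(a) integrands on a bigger cube
  obtain ⟨M, hNM, J, idx, G, W, q, hG, hq, hdec⟩ :=
    stub_spanToReps N h' c' R₁ F hR1' hsum' hHas' hFc hFz hspan
  obtain ⟨t'', ht''d, ht''i, hlift⟩ := exists_liftCube N M hNM t' ht'd
  -- (10) `[t''] ≡ Σⱼ [qⱼ]`, each `[qⱼ] ∈ relations`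
  have hsumq : of t'' - ∑ j, of (q j) ∈ relations := by
    refine of_sub_sum_integrand_mem_relations Finset.univ q t''
      (fun j _ => by rw [(hq j).1, ht''d]) ?_
    intro z hz
    rw [ht''d] at hz
    show t''.integrand z = ∑ j ∈ Finset.univ, (q j).integrand z
    rw [ht''i z hz, ht'i _ (fun l _ => hz (Fin.castLE hNM l) (mem_univ _)), hdec z hz]
  have hqrel : ∑ j, of (q j) ∈ relations :=
    AddSubgroup.sum_mem _ fun j _ =>
      stub_cubeCalibration M (idx j) (G j) (W j) (hG j).1 (hG j).2.1 (hG j).2.2.1 (hG j).2.2.2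
        (q j) (hq j).1 (hq j).2
  -- (11) assemble
  have : ∑ i, ε i • of (s i) =
      (∑ i, ε i • of (s i) - of t') + (of t' - of t'') + (of t'' - ∑ j, of (q j)) + ∑ j, of (q j) := by
    abel
  rw [this]
  exact relations.add_mem (relations.add_mem (relations.add_mem hxt' hlift) hsumq) hqrel

/-- **Kernel form on the cube–Nash subgroup.** Under Ayoub's Conjecture 1.1 over `ℚ̄`, every element of
`relations ⊔ closure {[t] | t cube–Nash}` with value `0` is a relation: write `c = y + Σ εᵢ [sᵢ]`
(`exists_normalForm_of_mem_sup`, LiftingCriteria), so `eval (Σ εᵢ [sᵢ]) = 0` by soundness, and apply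
`sum_cubeNash_mem_relations_of_typeA`. [cite: Ayoub2015, Conj. 1.1] -/
theorem mem_relations_of_mem_sup_cubeNash_of_typeA
    (hT : ∀ F ∈ AyoubRel.Oan (algebraMap (algebraicClosure ℚ ℂ) ℂ), AyoubRel.intC F = 0 →
      F ∈ AyoubRel.kSpan (algebraMap (algebraicClosure ℚ ℂ) ℂ)
        {x : AyoubRel.CSeries | ∃ G ∈ AyoubRel.Oan (algebraMap (algebraicClosure ℚ ℂ) ℂ),
          ∃ i : ℕ, x = AyoubRel.relAC i G})
    {c : FormalRep}
    (hc : c ∈ relations ⊔ AddSubgroup.closure {x : FormalRep | ∃ (m : ℕ) (t : IntegralRep m)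
      (g : (Fin m → ℝ) → ℝ) (U : Set (Fin m → ℝ)), IsOpen U ∧
      Set.pi Set.univ (fun _ : Fin m => Set.Icc (0:ℝ) 1) ⊆ U ∧ IsSemialgebraicFunOn ℚ U g ∧
      AnalyticOnNhd ℝ g U ∧ t.domain = Set.pi Set.univ (fun _ : Fin m => Set.Icc (0:ℝ) 1) ∧
      (∀ z ∈ Set.pi Set.univ (fun _ : Fin m => Set.Icc (0:ℝ) 1), t.integrand z = g z) ∧ x = of t})
    (h0 : eval c = 0) : c ∈ relations := by
  obtain ⟨S, n, g, U, ε, s, hNash, hs, hNF⟩ := exists_normalForm_of_mem_sup hc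
  have hsum0 : eval (∑ i, ε i • of (s i)) = 0 := by
    have := relations_le_ker_eval_holds hNF
    rw [AddMonoidHom.mem_ker, map_sub, h0, zero_sub, neg_eq_zero] at this
    exact this
  have hsum := sum_cubeNash_mem_relations_of_typeA hT S n g U ε s hNash hs hsum0
  have : c = (c - ∑ i, ε i • of (s i)) + ∑ i, ε i • of (s i) := by abel
  rw [this]
  exact relations.add_mem hNF hsum

/-! ## §3 (T) ∧ (N₁): the kernel conjecture, the crux, the summit -/

/-- **(T) ∧ (N₁) ⇒ `KZKernelConjecture`.** `eval x = 0` ⇒ `x ≡ [R] − [R']` with `R`, `R'` KZ-rational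
(`exists_integralRep_sub_holds`, `exists_isRational_equivalent_holds`) ⇒ (N₁) `x ≡ Σ εᵢ [sᵢ]` cube–Nash
⇒ `eval (Σ εᵢ [sᵢ]) = 0` (soundness) ⇒ (§2) `x ∈ relations`.
[cite: KontsevichZagier2001, §1.2 Conjecture 1] -/
theorem kzKernelConjecture_of_typeA_of_cubeNashNormalForm
    (hT : ∀ F ∈ AyoubRel.Oan (algebraMap (algebraicClosure ℚ ℂ) ℂ), AyoubRel.intC F = 0 →
      F ∈ AyoubRel.kSpan (algebraMap (algebraicClosure ℚ ℂ) ℂ)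
        {x : AyoubRel.CSeries | ∃ G ∈ AyoubRel.Oan (algebraMap (algebraicClosure ℚ ℂ) ℂ),
          ∃ i : ℕ, x = AyoubRel.relAC i G})
    (hN : CubeNashNormalForm) : KZKernelConjecture := by
  classical
  intro x hx
  -- (1) two rational representations
  obtain ⟨n, m, r, r', hrel⟩ := exists_integralRep_sub_holds x
  obtain ⟨n₁, R, hR, hrR⟩ := exists_isRational_equivalent_holds r
  obtain ⟨m₁, R', hR', hrR'⟩ := exists_isRational_equivalent_holds r'
  -- (2) Nash cube normal form
  obtain ⟨S, nS, g, U, ε, s, hNash, hs, hNF⟩ := hN n₁ m₁ R R' hR hR'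
  have hxs : x - ∑ i, ε i • of (s i) ∈ relations := by
    have : x - ∑ i, ε i • of (s i) = (x - (of r - of r')) + (of r - of R) - (of r' - of R') +
        (of R - of R' - ∑ i, ε i • of (s i)) := by abel
    rw [this]
    exact relations.add_mem (relations.sub_mem (relations.add_mem hrel hrR) hrR') hNF
  have hsum0 : eval (∑ i, ε i • of (s i)) = 0 := by
    have := relations_le_ker_eval_holds hxs
    rw [AddMonoidHom.mem_ker, map_sub, hx, zero_sub, neg_eq_zero] at this
    exact this
  have hsum := sum_cubeNash_mem_relations_of_typeA hT S nS g U ε s hNash hs hsum0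
  have : x = (x - ∑ i, ε i • of (s i)) + ∑ i, ε i • of (s i) := by abel
  rw [this]
  exact relations.add_mem hxs hsum

/-- **(T) ∧ (N₁) ⇒ the crux `StokesGeneration`** (`ker eval ≤ relations ≤ relations ⊔ closure S`).
[cite: KontsevichZagier2001, §1.2 Conjecture 1] -/
theorem stokesGeneration_of_typeA_of_cubeNashNormalForm
    (hT : ∀ F ∈ AyoubRel.Oan (algebraMap (algebraicClosure ℚ ℂ) ℂ), AyoubRel.intC F = 0 →
      F ∈ AyoubRel.kSpan (algebraMap (algebraicClosure ℚ ℂ) ℂ)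
        {x : AyoubRel.CSeries | ∃ G ∈ AyoubRel.Oan (algebraMap (algebraicClosure ℚ ℂ) ℂ),
          ∃ i : ℕ, x = AyoubRel.relAC i G})
    (hN : CubeNashNormalForm) : StokesGeneration := fun x hx =>
  AddSubgroup.mem_sup_left (kzKernelConjecture_of_typeA_of_cubeNashNormalForm hT hN x hx)

/-- **(T) ∧ (N₁) ⇒ the summit `KontsevichZagierPeriods`** (Kontsevich–Zagier's Conjecture 1 in its
printed two-representation form, via the tree's `kzKernelConjecture_iff_isRational`).
[cite: KontsevichZagier2001, §1.2 Conjecture 1] -/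
theorem kontsevichZagierPeriods_of_typeA_of_cubeNashNormalForm
    (hT : ∀ F ∈ AyoubRel.Oan (algebraMap (algebraicClosure ℚ ℂ) ℂ), AyoubRel.intC F = 0 →
      F ∈ AyoubRel.kSpan (algebraMap (algebraicClosure ℚ ℂ) ℂ)
        {x : AyoubRel.CSeries | ∃ G ∈ AyoubRel.Oan (algebraMap (algebraicClosure ℚ ℂ) ℂ),
          ∃ i : ℕ, x = AyoubRel.relAC i G})
    (hN : CubeNashNormalForm) : _root_.KontsevichZagierPeriods :=
  KontsevichZagierPeriods_iff.mpr
    (kzKernelConjecture_iff_isRational.mp (kzKernelConjecture_of_typeA_of_cubeNashNormalForm hT hN))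

/-- **The line reduction in registered form** (registered stub `stub_lineReduction` of the crux):
the two open stubs of the skeleton `Cruxes/StokesGeneration/Lines/Sketch.lean`,
`stub_cubeNashNormalForm` (N₁, verbatim) and `stub_typeAGeneration` (T, verbatim: Ayoub's
Conjecture 1.1 for every field `k` of characteristic `0` with algebraic image in `ℂ`), imply the
crux. Only the instance `k = ℚ̄` of (T) is used. [cite: Ayoub2015, Conj. 1.1] -/
theorem stub_lineReduction :
    (∀ (k k' : ℕ) (r : IntegralRep k) (r' : IntegralRep k'), r.IsRational → r'.IsRational →
      ∃ (S : ℕ) (n : Fin S → ℕ) (g : (i : Fin S) → (Fin (n i) → ℝ) → ℝ)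
        (U : (i : Fin S) → Set (Fin (n i) → ℝ)) (ε : Fin S → ℤ)
        (s : (i : Fin S) → IntegralRep (n i)),
        (∀ i, IsOpen (U i) ∧ Set.pi Set.univ (fun _ : Fin (n i) => Set.Icc (0:ℝ) 1) ⊆ (U i) ∧
          IsSemialgebraicFunOn ℚ (U i) (g i) ∧ AnalyticOnNhd ℝ (g i) (U i)) ∧
        (∀ i, (s i).domain = Set.pi Set.univ (fun _ : Fin (n i) => Set.Icc (0:ℝ) 1) ∧
          ∀ z ∈ Set.pi Set.univ (fun _ : Fin (n i) => Set.Icc (0:ℝ) 1), (s i).integrand z = g i z) ∧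
        of r - of r' - ∑ i, ε i • of (s i) ∈ relations) → (∀ (k : Type) [Field k] [CharZero k] (σ : k →+* ℂ), (∀ c : k, IsAlgebraic ℚ (σ c)) →
      ∀ F ∈ AyoubRel.Oan σ, AyoubRel.intC F = 0 →
        F ∈ AyoubRel.kSpan σ
          {x : AyoubRel.CSeries | ∃ G ∈ AyoubRel.Oan σ, ∃ i : ℕ, x = AyoubRel.relAC i G}) → StokesGeneration := by
  intro hN hT
  exact stokesGeneration_of_typeA_of_cubeNashNormalForm
    (hT (algebraicClosure ℚ ℂ) (algebraMap (algebraicClosure ℚ ℂ) ℂ) fun c =>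
      (mem_algebraicClosure_iff.1 c.2 : IsAlgebraic ℚ (algebraMap (algebraicClosure ℚ ℂ) ℂ c)))
    hN

/-! ## §4 (T) alone: the period conjecture for representations of dimension `≤ 1` -/

/-- **Ayoub's Conjecture 1.1 (over `ℚ̄`) implies the Kontsevich–Zagier conjecture for formal
combinations of representations of dimension `≤ 1`** — no normal-form hypothesis: every `x` in the
subgroup generated by the representations of dimension `0` and `1` (arbitrary `ℚ`-semialgebraic
domains in `ℝ⁰`, `ℝ¹` and integrands) with `eval x = 0` is a relation of the four-move calculus.
[cite: Ayoub2015, Conj. 1.1] -/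
theorem mem_relations_of_dimLEOne_of_typeA
    (hT : ∀ F ∈ AyoubRel.Oan (algebraMap (algebraicClosure ℚ ℂ) ℂ), AyoubRel.intC F = 0 →
      F ∈ AyoubRel.kSpan (algebraMap (algebraicClosure ℚ ℂ) ℂ)
        {x : AyoubRel.CSeries | ∃ G ∈ AyoubRel.Oan (algebraMap (algebraicClosure ℚ ℂ) ℂ),
          ∃ i : ℕ, x = AyoubRel.relAC i G})
    {x : FormalRep}
    (hx : x ∈ AddSubgroup.closure {y : FormalRep | ∃ (k : ℕ) (r : IntegralRep k), k ≤ 1 ∧ y = of r})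
    (h0 : eval x = 0) : x ∈ relations := by
  refine mem_relations_of_mem_sup_cubeNash_of_typeA hT ?_ h0
  refine (AddSubgroup.closure_le _).mpr ?_ hx
  rintro y ⟨k, r, hk, rfl⟩
  refine of_mem_of_dim_le_one _ le_sup_left (fun t g U h1 h2 h3 h4 h5 h6 => ?_) hk r
  exact AddSubgroup.mem_sup_right (AddSubgroup.subset_closure ⟨_, t, g, U, h1, h2, h3, h4, h5, h6, rfl⟩)

/-- **Two-representation form in dimension `≤ 1`.** Under Ayoub's Conjecture 1.1 over `ℚ̄`, any two
integral representations of dimensions `≤ 1` with the same value are KZ-equivalent (connected by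
the four moves). [cite: Ayoub2015, Conj. 1.1] -/
theorem equivalent_of_value_eq_of_dimLEOne_of_typeA
    (hT : ∀ F ∈ AyoubRel.Oan (algebraMap (algebraicClosure ℚ ℂ) ℂ), AyoubRel.intC F = 0 →
      F ∈ AyoubRel.kSpan (algebraMap (algebraicClosure ℚ ℂ) ℂ)
        {x : AyoubRel.CSeries | ∃ G ∈ AyoubRel.Oan (algebraMap (algebraicClosure ℚ ℂ) ℂ),
          ∃ i : ℕ, x = AyoubRel.relAC i G})
    {n m : ℕ} (hn : n ≤ 1) (hm : m ≤ 1) (r : IntegralRep n) (r' : IntegralRep m)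
    (hv : r.value = r'.value) : Equivalent r r' := by
  show of r - of r' ∈ relations
  refine mem_relations_of_dimLEOne_of_typeA hT (AddSubgroup.sub_mem _
    (AddSubgroup.subset_closure ⟨n, r, hn, rfl⟩) (AddSubgroup.subset_closure ⟨m, r', hm, rfl⟩)) ?_
  rw [map_sub, eval_of, eval_of, hv, sub_self]

end Summit.KontsevichZagierPeriods.KontsevichZagierPeriods.StokesGenerationLine
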